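import Summits.Ventures.HodgeRepro.Faces
import Summits.Ventures.HodgeRepro.Night3FacePieces

/-!
# «S4-faces ⟹ S4» on the `(G, c)` model: the closure principle for multisets of CM types of a Galois CM field

Blind re-derivation cell `pub-hodge-repro`, seat `night-3`.  Mathlib + typer's `Faces` (hence `CMType`, …) +
`Night3FacePieces` (hence typer-2's `FaceLatticeCore` and `Night3ClosureAbstract`) only.  Namespace `HodgeRepro.Night3.GSet`.

`Night3FacePieces.lean` proves the closure principle «S4 on the pieces + Lemma P ⟹ S4 on every zero-sum multiset» for
CM types written as sign vectors `Fin m → Bool`, conditional on Lemma L for `m` (`alg_of_faces_of_spanEq`; Lemma L is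
typer-2's `FaceLattice.span_pairs_faces_eq_zeroSum`, discharged in `Night3FaceClosureGSetFull`).  This file transports it to the cell's structural model of a
Galois CM field (typer's `CMType.lean` / `Faces.lean`): a finite group `G` with a complex conjugation `c`
(`IsComplexConj`), CM types `Φ ⊆ G` (`IsCMType c Φ`), places `{p, c p}` (`place`), flips `flipAt c p`, and the
census faces `faceCorners c Φ p p'` = `Φ, (Φ̄)^{(p)}, (Φ̄)^{(p')}, Φ^{(p p')}` — the objects of ROUTE.md §3.1–§3.4
and of the sealed statement (a).

* `IsPlaceReps c r`: `r : Fin m → G` is a system of place representatives (every embedding lies in exactly one place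
  `{r i, c r i}`); `exists_placeReps`: such a system exists for every `(G, c)`;
* `toSign r T` (the sign vector of a subset of embeddings) and `ofSign c r S` (the CM type with a given sign vector) are
  inverse bijections between CM types and sign vectors (`toSign_ofSign`, `ofSign_toSign`, `isCMType_ofSign`) and
  intertwine conjugation / flips with `conj` / `flip` (`ofSign_conj`, `ofSign_flip`);
* `IsZeroSumG c M`: a multiset of CM types in which every embedding lies in exactly half of the members — (eq2) of
  ROUTE.md §3.6; for four members it is typer's `SumTwo` (`isZeroSumG_familyMul_iff_sumTwo`); `isZeroSumG_iff`: it is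
  `IsZeroSum` of the multiset of sign vectors; `faceCornersMul c Φ p p'`: the corners of the face `(Φ; p, p')` as a
  multiset (`faceCornersMul_eq`: typer's `faceCorners`, listed);
* **`alg_of_faces_gset`**: the closure principle — for every predicate `Alg` on multisets of CM types of `(G, c)`
  satisfying product closure and cancellation on zero-sum multisets, `Alg` on every conjugate pair `{Φ, c • Φ}` and on
  every census face `faceCornersMul c Φ p p'` (`p' ∉ place c p`) gives `Alg` on every zero-sum multiset — with Lemma L
  for `m` (`hL`) as its one lattice hypothesis; `alg_of_faces_gset'` is the form without the datum `r`.

As in `Night3FaceClosure.lean`, what stays on paper is exactly the content of the hypotheses `hadd` / `hcancel` / `hpair`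
(Lemma P (1)–(3), Lefschetz (1,1)); nothing closes S4.  No sealed file is touched; no Tier-2 item depends on this file.
-/

set_option autoImplicit false

namespace HodgeRepro.Night3.GSet

open Finset
open HodgeRepro.FaceLattice
open scoped Pointwise

variable {G : Type*} [Group G] [DecidableEq G] {m : ℕ}

/-! ### Systems of place representatives -/

/-- `r : Fin m → G` is a SYSTEM OF PLACE REPRESENTATIVES for `(G, c)`: every embedding lies in exactly one of the
places `{r i, c r i}`. -/
def IsPlaceReps (c : G) (r : Fin m → G) : Prop := ∀ g : G, ∃! i, g ∈ place c (r i)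

section Reps

variable {c : G} {r : Fin m → G}

/-- Every embedding lies in some place `{r i, c r i}`. -/
theorem IsPlaceReps.exists_mem (hr : IsPlaceReps c r) (g : G) : ∃ i, g ∈ place c (r i) := (hr g).exists

/-- An embedding lies in at most one place `{r i, c r i}`. -/
theorem IsPlaceReps.eq_of_mem (hr : IsPlaceReps c r) {g : G} {i j : Fin m} (hi : g ∈ place c (r i))
    (hj : g ∈ place c (r j)) : i = j := (hr g).unique hi hj

/-- `r i` lies in the place of `r j` iff `i = j`. -/
theorem IsPlaceReps.mem_place_iff (hr : IsPlaceReps c r) (i j : Fin m) : r i ∈ place c (r j) ↔ i = j :=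
  ⟨fun h => hr.eq_of_mem (mem_place_self c (r i)) h, fun h => h ▸ mem_place_self c (r i)⟩

/-- A system of representatives of a nonempty group has at least one place. -/
theorem IsPlaceReps.pos (hr : IsPlaceReps c r) [Nonempty G] : 0 < m :=
  (hr.exists_mem (Classical.arbitrary G)).elim fun i _ => Fin.pos i

end Reps

/-- The place of a member of a place is that place. -/
theorem place_eq_of_mem {c : G} (hc : IsComplexConj c) {p x : G} (h : x ∈ place c p) : place c x = place c p := by
  rcases mem_place.1 h with rfl | rfl
  · rfl
  · rw [place, place, hc.mul_mul_cancel, Finset.pair_comm]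

section Exists

variable [Fintype G]

/-- The places of `(G, c)`, as a finite set of finite sets. -/
def placeSet (c : G) : Finset (Finset G) := Finset.univ.image (place c)
/-- **A system of place representatives exists** for every `(G, c)` (one element chosen in each place). -/
theorem exists_placeReps {c : G} (hc : IsComplexConj c) : ∃ (m : ℕ) (r : Fin m → G), IsPlaceReps c r := by
  classical
  let e : placeSet c ≃ Fin (placeSet c).card := (placeSet c).equivFin
  have hmem : ∀ P : placeSet c, ∃ p : G, place c p = P.1 := fun P => by
    obtain ⟨p, -, hp⟩ := Finset.mem_image.1 P.2
    exact ⟨p, hp⟩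
  refine ⟨(placeSet c).card, fun i => Classical.choose (hmem (e.symm i)), fun g => ?_⟩
  have hplace : ∀ i, place c (Classical.choose (hmem (e.symm i))) = (e.symm i).1 := fun i =>
    Classical.choose_spec (hmem (e.symm i))
  have hg : place c g ∈ placeSet c := Finset.mem_image_of_mem _ (Finset.mem_univ g)
  refine ⟨e ⟨place c g, hg⟩, ?_, ?_⟩
  · show g ∈ place c (Classical.choose (hmem (e.symm (e ⟨place c g, hg⟩))))
    rw [hplace, Equiv.symm_apply_apply]
    exact mem_place_self c g
  · intro j hj
    have h1 : place c g = (e.symm j).1 := by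
      rw [← hplace j]
      exact (place_eq_of_mem hc hj)
    have h2 : e.symm j = ⟨place c g, hg⟩ := Subtype.ext h1.symm
    rw [← h2, Equiv.apply_symm_apply]

end Exists

/-! ### Sign vectors of CM types -/

/-- The sign vector of a subset of embeddings: `true` at the place `i` iff the representative `r i` belongs to it. -/
def toSign (r : Fin m → G) (T : Finset G) : CMType m := fun i => decide (r i ∈ T)

omit [Group G] in
/-- `toSign` evaluated. -/
theorem toSign_apply (r : Fin m → G) (T : Finset G) (i : Fin m) : toSign r T i = decide (r i ∈ T) := rfl

omit [Group G] in
/-- `toSign r T i = true` iff `r i ∈ T`. -/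
theorem toSign_apply_eq_true (r : Fin m → G) (T : Finset G) (i : Fin m) : toSign r T i = true ↔ r i ∈ T := by simp [toSign]

omit [Group G] in
/-- `toSign r T i = false` iff `r i ∉ T`. -/
theorem toSign_apply_eq_false (r : Fin m → G) (T : Finset G) (i : Fin m) : toSign r T i = false ↔ r i ∉ T := by simp [toSign]

/-- The CM type with a given sign vector: at the place `i` take `r i` if `S i`, else `c r i`. -/
def ofSign (c : G) (r : Fin m → G) (S : CMType m) : Finset G :=
  Finset.univ.image fun i => if S i then r i else c * r i

/-- Membership in `ofSign`. -/
theorem mem_ofSign {c : G} {r : Fin m → G} {S : CMType m} {g : G} :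
    g ∈ ofSign c r S ↔ ∃ i, (S i = true ∧ g = r i) ∨ (S i = false ∧ g = c * r i) := by
  simp only [ofSign, Finset.mem_image, Finset.mem_univ, true_and]
  constructor
  · rintro ⟨i, hi⟩
    cases h : S i
    · rw [h] at hi; simp only [Bool.false_eq_true, if_false] at hi; exact ⟨i, Or.inr ⟨h, hi.symm⟩⟩
    · rw [h] at hi; simp only [if_true] at hi; exact ⟨i, Or.inl ⟨h, hi.symm⟩⟩
  · rintro ⟨i, (⟨h, rfl⟩ | ⟨h, rfl⟩)⟩
    · exact ⟨i, by simp [h]⟩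
    · exact ⟨i, by simp [h]⟩

section Bijection

variable {c : G} (hc : IsComplexConj c) {r : Fin m → G} (hr : IsPlaceReps c r)
include hc hr

omit hc in
/-- Membership in `ofSign` at an embedding of the place `i`. -/
theorem mem_ofSign_of_mem_place {g : G} {i : Fin m} (hg : g ∈ place c (r i)) (S : CMType m) :
    g ∈ ofSign c r S ↔ (g = r i ∧ S i = true) ∨ (g = c * r i ∧ S i = false) := by
  rw [mem_ofSign]
  constructor
  · rintro ⟨j, (⟨hj, rfl⟩ | ⟨hj, rfl⟩)⟩
    · obtain rfl := hr.eq_of_mem (mem_place_self c (r j)) hg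
      exact Or.inl ⟨rfl, hj⟩
    · obtain rfl := hr.eq_of_mem (conj_mem_place c (r j)) hg
      exact Or.inr ⟨rfl, hj⟩
  · rintro (⟨rfl, h⟩ | ⟨rfl, h⟩)
    · exact ⟨i, Or.inl ⟨h, rfl⟩⟩
    · exact ⟨i, Or.inr ⟨h, rfl⟩⟩

/-- `ofSign` is a right inverse of `toSign`. -/
theorem toSign_ofSign (S : CMType m) : toSign r (ofSign c r S) = S := by
  funext i
  rw [toSign_apply]
  have h := mem_ofSign_of_mem_place hr (mem_place_self c (r i)) S
  cases hS : S i
  · apply decide_eq_false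
    rw [h, hS]
    simp [Ne.symm (hc.mul_ne_self (r i))]
  · apply decide_eq_true
    rw [h, hS]
    simp

/-- `ofSign c r S` is a CM type. -/
theorem isCMType_ofSign (S : CMType m) : IsCMType c (ofSign c r S) := by
  intro g
  obtain ⟨i, hg⟩ := hr.exists_mem g
  have hcg : c * g ∈ place c (r i) := (conj_mem_place_iff hc).2 hg
  rw [mem_ofSign_of_mem_place hr hg S, mem_ofSign_of_mem_place hr hcg S]
  rcases mem_place.1 hg with rfl | rfl
  · cases S i <;> simp [hc.mul_ne_self (r i), Ne.symm (hc.mul_ne_self (r i))]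
  · rw [hc.mul_mul_cancel]
    cases S i <;> simp [hc.mul_ne_self (r i), Ne.symm (hc.mul_ne_self (r i))]

/-- `ofSign` is a left inverse of `toSign` on CM types. -/
theorem ofSign_toSign {T : Finset G} (hT : IsCMType c T) : ofSign c r (toSign r T) = T := by
  ext g
  obtain ⟨i, hg⟩ := hr.exists_mem g
  rw [mem_ofSign_of_mem_place hr hg, toSign_apply_eq_true, toSign_apply_eq_false]
  rcases mem_place.1 hg with rfl | rfl
  · simp [Ne.symm (hc.mul_ne_self (r i))]
  · rw [hT.conj_mem_iff]
    simp [hc.mul_ne_self (r i)]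

/-- `ofSign` intertwines `conj` with complex conjugation. -/
theorem ofSign_conj (S : CMType m) : ofSign c r (conj S) = c • ofSign c r S := by
  ext g
  rw [hc.mem_smul_iff]
  obtain ⟨i, hg⟩ := hr.exists_mem g
  have hcg : c * g ∈ place c (r i) := (conj_mem_place_iff hc).2 hg
  rw [mem_ofSign_of_mem_place hr hg (conj S), mem_ofSign_of_mem_place hr hcg S]
  rcases mem_place.1 hg with rfl | rfl
  · cases hS : S i <;> simp [hS, hc.mul_ne_self (r i), Ne.symm (hc.mul_ne_self (r i))]
  · rw [hc.mul_mul_cancel]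
    cases hS : S i <;> simp [hS, hc.mul_ne_self (r i), Ne.symm (hc.mul_ne_self (r i))]

/-- `ofSign` intertwines `flip p` with the flip at the place of `r p`. -/
theorem ofSign_flip (S : CMType m) (p : Fin m) :
    ofSign c r (FaceLattice.flip p S) = flipAt c (r p) (ofSign c r S) := by
  ext g
  rw [mem_flipAt]
  obtain ⟨i, hg⟩ := hr.exists_mem g
  rw [mem_ofSign_of_mem_place hr hg (FaceLattice.flip p S), mem_ofSign_of_mem_place hr hg S]
  by_cases hip : i = p
  · subst hip
    rw [flip_apply_self]
    rcases mem_place.1 hg with rfl | rfl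
    · cases S i <;> simp [Ne.symm (hc.mul_ne_self (r i)), mem_place_self]
    · cases S i <;> simp [hc.mul_ne_self (r i), conj_mem_place]
  · have hgp : g ∉ place c (r p) := fun h => hip (hr.eq_of_mem hg h)
    rw [flip_apply_of_ne hip]
    simp [hgp]

end Bijection

/-! ### Multisets of CM types in the `(G, c)` model -/

/-- Every member of `M` is a CM type. -/
def IsCMMultiset (c : G) (M : Multiset (Finset G)) : Prop := ∀ T ∈ M, IsCMType c T

/-- A multiset of CM types of `(G, c)` is ZERO-SUM when every embedding lies in exactly half of its members —
the condition (eq2) of ROUTE.md §3.6 (for four members: typer's `SumTwo`). -/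
def IsZeroSumG (c : G) (M : Multiset (Finset G)) : Prop :=
  IsCMMultiset c M ∧ ∀ x : G, 2 * (M.filter fun T => x ∈ T).card = Multiset.card M

omit [Group G] in
/-- The number of members containing `r i`, read off the sign vectors. -/
theorem card_filter_map_toSign_true (r : Fin m → G) (M : Multiset (Finset G)) (i : Fin m) :
    ((M.map (toSign r)).filter fun S => S i = true).card = (M.filter fun T => r i ∈ T).card := by
  rw [Multiset.filter_map, Multiset.card_map]
  congr 1
  exact Multiset.filter_congr fun T _ => by simp [toSign]

omit [Group G] in
/-- The number of members not containing `r i`, read off the sign vectors. -/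
theorem card_filter_map_toSign_false (r : Fin m → G) (M : Multiset (Finset G)) (i : Fin m) :
    ((M.map (toSign r)).filter fun S => S i = false).card = (M.filter fun T => r i ∉ T).card := by
  rw [Multiset.filter_map, Multiset.card_map]
  congr 1
  exact Multiset.filter_congr fun T _ => by simp [toSign]

/-- The two complementary filters of a multiset have complementary cardinalities. -/
theorem card_filter_add_card_filter_not {α : Type*} (M : Multiset α) (p : α → Prop) [DecidablePred p] :
    (M.filter p).card + (M.filter fun a => ¬ p a).card = Multiset.card M := by rw [← Multiset.card_add, Multiset.filter_add_not]

/-- In a multiset of CM types, the members not containing `g` are those containing `c g`. -/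
theorem card_filter_not_mem {c : G} {M : Multiset (Finset G)} (hM : IsCMMultiset c M) (g : G) :
    (M.filter fun T => g ∉ T).card = (M.filter fun T => c * g ∈ T).card := by
  congr 1
  exact Multiset.filter_congr fun T hT => ((hM T hT).conj_mem_iff g).symm

section ZeroSum

variable {c : G} (hc : IsComplexConj c) {r : Fin m → G} (hr : IsPlaceReps c r)
include hc hr

omit hc in
/-- A multiset of CM types is zero-sum iff its multiset of sign vectors is zero-sum. -/
theorem isZeroSumG_iff {M : Multiset (Finset G)} (hM : IsCMMultiset c M) :
    IsZeroSumG c M ↔ IsZeroSum (M.map (toSign r)) := by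
  rw [IsZeroSumG, isZeroSum_iff]
  simp only [card_filter_map_toSign_true, card_filter_map_toSign_false]
  constructor
  · rintro ⟨-, h⟩ i
    have h1 := h (r i)
    have h2 := card_filter_add_card_filter_not M fun T => r i ∈ T
    omega
  · intro h
    refine ⟨hM, fun x => ?_⟩
    obtain ⟨i, hx⟩ := hr.exists_mem x
    have h1 := h i
    have h2 := card_filter_add_card_filter_not M fun T => r i ∈ T
    rcases mem_place.1 hx with rfl | rfl
    · omega
    · rw [← card_filter_not_mem hM]
      omega

/-- `ofSign` applied memberwise produces a multiset of CM types. -/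
theorem isCMMultiset_map_ofSign (X : Multiset (CMType m)) : IsCMMultiset c (X.map (ofSign c r)) := by
  intro T hT
  obtain ⟨S, -, rfl⟩ := Multiset.mem_map.1 hT
  exact isCMType_ofSign hc hr S

/-- `toSign ∘ ofSign` is the identity on multisets of sign vectors. -/
theorem map_toSign_map_ofSign (X : Multiset (CMType m)) : (X.map (ofSign c r)).map (toSign r) = X := by
  rw [Multiset.map_map]; exact (Multiset.map_congr rfl fun S _ => toSign_ofSign hc hr S).trans (Multiset.map_id' X)

/-- `ofSign ∘ toSign` is the identity on multisets of CM types. -/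
theorem map_ofSign_map_toSign {M : Multiset (Finset G)} (hM : IsCMMultiset c M) :
    (M.map (toSign r)).map (ofSign c r) = M := by
  rw [Multiset.map_map]; exact (Multiset.map_congr rfl fun T hT => ofSign_toSign hc hr (hM T hT)).trans (Multiset.map_id' M)

/-- The multiset of CM types with a given zero-sum multiset of sign vectors is zero-sum. -/
theorem isZeroSumG_map_ofSign {X : Multiset (CMType m)} (hX : IsZeroSum X) : IsZeroSumG c (X.map (ofSign c r)) := by
  rw [isZeroSumG_iff hr (isCMMultiset_map_ofSign hc hr X), map_toSign_map_ofSign hc hr]; exact hX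

end ZeroSum

/-! ### Families, `SumTwo`, faces as multisets, and the closure principle -/

/-- The multiset of members of a finite family of subsets of embeddings. -/
def familyMul {ι : Type*} [Fintype ι] (T : ι → Finset G) : Multiset (Finset G) := Finset.univ.val.map T

omit [Group G] in
/-- The number of members of a family containing `x`, as a multiset count. -/
theorem card_filter_familyMul {ι : Type*} [Fintype ι] (T : ι → Finset G) (x : G) :
    ((familyMul T).filter fun S => x ∈ S).card = (Finset.univ.filter fun i => x ∈ T i).card := by
  rw [familyMul, Multiset.filter_map, Multiset.card_map, Finset.card_def, Finset.filter_val]; rfl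

/-- A family of `2p` CM types is zero-sum iff every embedding lies in exactly `p` of its members; for `p = 2` this is
typer's `SumTwo` (`FaceReduce.lean`), the property of every face of the sealed census. -/
theorem isZeroSumG_familyMul_iff_sumTwo {c : G} {T : Fin 4 → Finset G} (hT : ∀ i, IsCMType c (T i)) :
    IsZeroSumG c (familyMul T) ↔ SumTwo T := by
  have hcard : Multiset.card (familyMul T) = 4 := by simp [familyMul]
  have hmem : IsCMMultiset c (familyMul T) := by
    intro S hS
    obtain ⟨i, -, rfl⟩ := Multiset.mem_map.1 hS
    exact hT i
  simp only [IsZeroSumG, hmem, true_and, hcard, card_filter_familyMul, SumTwo]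
  exact forall_congr' fun x => by omega

/-- The four corners of the face `(Φ; p, p')` as a multiset: `Φ, (Φ̄)^{(p)}, (Φ̄)^{(p')}, Φ^{(p p')}`. -/
def faceCornersMul (c : G) (Φ : Finset G) (p p' : G) : Multiset (Finset G) :=
  {Φ, flipAt c p (c • Φ), flipAt c p' (c • Φ), flipAt c p' (flipAt c p Φ)}

/-- `faceCornersMul` lists typer's `faceCorners`. -/
theorem faceCornersMul_eq (c : G) (Φ : Finset G) (p p' : G) :
    faceCornersMul c Φ p p' =
      {faceCorners c Φ p p' 0, faceCorners c Φ p p' 1, faceCorners c Φ p p' 2, faceCorners c Φ p p' 3} :=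
  rfl

/-- **«S4-faces ⟹ S4» on the `(G, c)` model.**  Let `c` be a complex conjugation of the finite group `G`, `r` a
system of place representatives (`m` places), `hL` Lemma L for `m` places (typer-2's `span_pairs_faces_eq_zeroSum`,
discharged in `Night3FaceClosureGSetFull`), and `Alg` a predicate on multisets of CM types of `(G, c)` (read:
`Alg M` = «the Weil space of the corner product over `M` is algebraic») such that

* `hadd` (product closure, Lemma P (1)): `Alg M → Alg N → Alg (M + N)` for zero-sum `M`, `N`;
* `hcancel` (cancellation, Lemma P (2)–(3)): `Alg (M + N) → Alg N → Alg M` for zero-sum `M`, `N`;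
* `hpair` (divisor classes, Lefschetz (1,1)): `Alg {Φ, c • Φ}` for every CM type `Φ`;
* `hface` (S4 on the census faces): `Alg (faceCornersMul c Φ p p')` for every CM type `Φ` and `p' ∉ place c p`.

Then `Alg M` for EVERY zero-sum multiset `M` of CM types of `(G, c)`. -/
theorem alg_of_faces_gset {c : G} (hc : IsComplexConj c) {r : Fin m → G} (hr : IsPlaceReps c r)
    (hL : Submodule.span ℤ (pairs m ∪ faces m) = zeroSum m) (Alg : Multiset (Finset G) → Prop)
    (hadd : ∀ M N, IsZeroSumG c M → IsZeroSumG c N → Alg M → Alg N → Alg (M + N))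
    (hcancel : ∀ M N, IsZeroSumG c M → IsZeroSumG c N → Alg (M + N) → Alg N → Alg M)
    (hpair : ∀ Φ, IsCMType c Φ → Alg {Φ, c • Φ})
    (hface : ∀ Φ p p', IsCMType c Φ → p' ∉ place c p → Alg (faceCornersMul c Φ p p'))
    (M : Multiset (Finset G)) (hM : IsZeroSumG c M) : Alg M := by
  have key : ∀ X : Multiset (CMType m), IsZeroSum X → Alg (X.map (ofSign c r)) := by
    intro X hX
    refine alg_of_faces_of_spanEq hL (fun X => Alg (X.map (ofSign c r))) ?_ ?_ ?_ ?_ X hX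
    · intro X Y hX hY hAX hAY
      rw [Multiset.map_add]
      exact hadd _ _ (isZeroSumG_map_ofSign hc hr hX) (isZeroSumG_map_ofSign hc hr hY) hAX hAY
    · intro X Y hX hY hAXY hAY
      rw [Multiset.map_add] at hAXY
      exact hcancel _ _ (isZeroSumG_map_ofSign hc hr hX) (isZeroSumG_map_ofSign hc hr hY) hAXY hAY
    · intro S
      have h := hpair (ofSign c r S) (isCMType_ofSign hc hr S)
      simpa [pairMul, Multiset.insert_eq_cons, ofSign_conj hc hr] using h
    · intro S p p' hpp'
      have h1 : r p' ∉ place c (r p) := fun h => hpp' ((hr.mem_place_iff p' p).1 h).symm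
      have h := hface (ofSign c r S) (r p) (r p') (isCMType_ofSign hc hr S) h1
      simpa [faceMul, quadMul, faceCornersMul, Multiset.insert_eq_cons, ofSign_conj hc hr, ofSign_flip hc hr] using h
  have h := key (M.map (toSign r)) ((isZeroSumG_iff hr hM.1).1 hM)
  rwa [map_ofSign_map_toSign hc hr hM.1] at h

/-- **«S4-faces ⟹ S4» on the `(G, c)` model, without the datum `r`**: for every finite group `G` with a complex
conjugation `c`, the closure principle holds (a system of place representatives exists, `exists_placeReps`), given Lemma L
for every number of places (`hL`). -/
theorem alg_of_faces_gset' [Fintype G] {c : G} (hc : IsComplexConj c)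
    (hL : ∀ m, 0 < m → Submodule.span ℤ (pairs m ∪ faces m) = zeroSum m) (Alg : Multiset (Finset G) → Prop)
    (hadd : ∀ M N, IsZeroSumG c M → IsZeroSumG c N → Alg M → Alg N → Alg (M + N))
    (hcancel : ∀ M N, IsZeroSumG c M → IsZeroSumG c N → Alg (M + N) → Alg N → Alg M)
    (hpair : ∀ Φ, IsCMType c Φ → Alg {Φ, c • Φ})
    (hface : ∀ Φ p p', IsCMType c Φ → p' ∉ place c p → Alg (faceCornersMul c Φ p p'))
    (M : Multiset (Finset G)) (hM : IsZeroSumG c M) : Alg M := by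
  obtain ⟨m, r, hr⟩ := exists_placeReps hc
  haveI : Nonempty G := ⟨c⟩
  exact alg_of_faces_gset hc hr (hL m hr.pos) Alg hadd hcancel hpair hface M hM

end HodgeRepro.Night3.GSet
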